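import Summits.FinalStateConjecture.FinalStateConjecture.Theorems.BartnikGapSettlingSettledCaptureCrushDefs
import Literature.Geometry.Lorentzian.KerrSchildCoord
import Literature.Geometry.Lorentzian.CoordScalarCurvatureEvolution
import HarnessLib

/-!
# Crux `SettledCapture` (stmt-FinalStateConjecture-17328), line `null-concave-crush`, stub
# `stub_crushTransport` — part 1/5: local `C¹`-stability of the Kerr crush certificate (jet level)

Route `BartnikGapSettling`; helper module (`--supports stmt-FinalStateConjecture-17328`) of the
registered stub `stub_crushTransport` (`Theorems/BartnikGapSettlingSettledCaptureStubCrushTransport.lean`),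
vocabulary of `Theorems/BartnikGapSettlingSettledCaptureCrushDefs.lean`. Pure finite-dimensional analysis
over the coordinate tensor calculus of `Literature/Geometry/Lorentzian/CoordCurvature.lean` (`koszulOp`,
`chrAt`) and `CoordScalarCurvatureEvolution.lean` (`hessAt`): the coordinate Hessian
`hessAt G f x w w = D²f(x)(w,w) − Df(x)(½ (G x)⁻¹ (koszulOp (DG(x)) w w))` depends continuously on the
jet `(G x, DG(x))` wherever `G x` is invertible, so the two strict inequalities of a Kerr crush
certificate WITH MARGIN (`KerrCrushCertificate`: slope `≤ −m‖w‖` on future null `w`, weighted concavity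
`≤ −m‖w‖²` on null `w`), together with invertibility of the form and timelikeness of the Kerr field
`V = −g♯dt*`, persist for all nearby points, directions and all small perturbations of the `1`-jet
(`crushTransport_good_eventually`; the sign of `g(w, V)` on the null cone is decided by `V^⊥` being
spacelike, `crushTransport_bilin_timeVector_ne_zero`). The generalised tube lemma
`crushTransport_tube` (pattern of `Theorems/BartnikGapSettlingGapExhaustionHessMarginStable.lean`) makes
the perturbation size uniform over compact sets (used in part 2/5).

## References
* B. O'Neill, *Semi-Riemannian geometry with applications to relativity*, Academic Press 1983, Ch. 3,
  Cor. 21, Lemma 22, Lemma 3.49, Prop. 3.59 and pp. 90–91; Ch. 5, Lemma 5.26, Lemma 5.29. [ONeill1983]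
* M. Dafermos, I. Rodnianski, arXiv:0811.0354, §5.1 (ingoing Kerr–Schild coordinates). [arXiv08110354]
* M. Dafermos, J. Luk, arXiv:1710.01722 (the Kerr interior: red-shift and no-shift regions). [DafermosLuk2017]
-/

noncomputable section

-- instance search through the nested operator types `E4 →L[ℝ] E4 →L[ℝ] E4 →L[ℝ] ℝ`
set_option maxSynthPendingDepth 3

-- D-0017: single-problem summit, `Summit.<S>.<S>.…` by design (cf. lakefile `weak.linter.dupNamespace`).
set_option linter.dupNamespace false

namespace Summit.FinalStateConjecture.FinalStateConjecture.Theorems.BartnikGapSettling.SettledCapture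

open Set Filter Function TopologicalSpace
open scoped Manifold ContDiff Topology ENNReal
open Literature.Geometry.Lorentzian Literature.Geometry.Lorentzian.MetricCoord

/-! ### Part I. `C¹`-stability of the Kerr crush certificate (pure finite-dimensional analysis) -/

section Perturbation

/-- Generalised tube lemma: a property of `(z, p)` holding near `(z, 0)` for every `z` in a compact set
`K` holds for all `z ∈ K` and all `‖p‖ ≤ δ`, for some uniform `δ > 0`. [folklore] -/
theorem crushTransport_tube {X P : Type*} [TopologicalSpace X] [SeminormedAddCommGroup P] {K : Set X}
    (hK : IsCompact K) {good : X × P → Prop} (h : ∀ z ∈ K, ∀ᶠ q in 𝓝 (z, (0 : P)), good q) :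
    ∃ δ : ℝ, 0 < δ ∧ ∀ z ∈ K, ∀ p : P, ‖p‖ ≤ δ → good (z, p) := by
  -- adapted from Theorems/BartnikGapSettlingGapExhaustionHessMarginStable (`hessMarginStable_tube`)
  have hmem : {q | good q} ∈ (𝓝ˢ K) ×ˢ 𝓝 (0 : P) :=
    hK.mem_nhdsSet_prod_of_forall fun z hz => by rw [← nhds_prod_eq]; exact h z hz
  obtain ⟨A, hA, B, hB, hAB⟩ := Filter.mem_prod_iff.1 hmem
  obtain ⟨ε, hε, hεB⟩ := Metric.mem_nhds_iff.1 hB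
  refine ⟨ε / 2, half_pos hε, fun z hz p hp => hAB (mk_mem_prod (subset_of_mem_nhdsSet hA hz) ?_)⟩
  exact hεB (mem_ball_zero_iff.2 (hp.trans_lt (half_lt_self hε)))

/-- A null vector of the Kerr–Schild form which is orthogonal to the timelike field `V` vanishes
(`V^⊥` is spacelike). [cite: ONeill1983, Ch. 5, Lemma 5.26] -/
theorem crushTransport_bilin_timeVector_ne_zero {M a : ℝ} (hM : 0 ≤ M) {y : E4} (hy : 0 < Kerr.radius a y)
    {v : E4} (hv : Kerr.bilin M a y v v = 0) (hv0 : v ≠ 0) :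
    Kerr.bilin M a y v (Kerr.timeVector M a y) ≠ 0 := by
  intro h
  have h' : Kerr.bilin M a y (Kerr.timeVector M a y) v = 0 := by rw [Kerr.bilin_symm]; exact h
  have hpos := Kerr.bilin_pos_of_orthogonal M a hy _ _ (Kerr.bilin_timeVector_timeVector_neg hM a hy) h' hv0
  rw [hv] at hpos
  exact lt_irrefl _ hpos

/-- The local step: near `((y, v), 0)` the margin-free certificate holds for the PERTURBED `1`-jet
`(g_{M,a}(y') + p.1, Dg_{M,a}(y') + p.2)` in the direction `v'` — the perturbed form is invertible,
`V` is timelike for it, and if `v'` is null for it then (future-directed ⇒ strictly decreasing) and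
(strict weighted concavity of the jet Hessian) — for a shell point `y` of the exact-Kerr certificate and
any direction `v ≠ 0` (continuity of the jet functional, openness of invertibility, and the strict
margins of the certificate at the base point). [folklore] -/
theorem crushTransport_good_eventually {M a r₁ r₂ ρ m : ℝ} {F : ℝ → ℝ} (hM : 0 ≤ M) (hm : 0 < m)
    (hcert : KerrCrushCertificate M a r₁ r₂ ρ m F) {y : E4} (hy : 0 < Kerr.radius a y)
    (hy₁ : r₁ ≤ Kerr.radius a y) (hy₂ : Kerr.radius a y ≤ r₂) {v : E4} (hv : v ≠ 0) :
    ∀ᶠ q in 𝓝 (((y, v), 0) : (E4 × E4) × ((E4 →L[ℝ] E4 →L[ℝ] ℝ) × (E4 →L[ℝ] E4 →L[ℝ] E4 →L[ℝ] ℝ))),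
      (Kerr.bilin M a q.1.1 + q.2.1).IsInvertible ∧ (Kerr.bilin M a q.1.1 + q.2.1) (Kerr.timeVector M a q.1.1) (Kerr.timeVector M a q.1.1) < 0 ∧
        ((Kerr.bilin M a q.1.1 + q.2.1) q.1.2 q.1.2 = 0 →
          ((Kerr.bilin M a q.1.1 + q.2.1) q.1.2 (Kerr.timeVector M a q.1.1) < 0 → fderiv ℝ (F ∘ Kerr.radius a) q.1.1 q.1.2 < 0) ∧
            F (Kerr.radius a q.1.1) * (fderiv ℝ (fderiv ℝ (F ∘ Kerr.radius a)) q.1.1 q.1.2 q.1.2 - fderiv ℝ (F ∘ Kerr.radius a) q.1.1 ((2⁻¹ : ℝ) • (Kerr.bilin M a q.1.1 + q.2.1).inverse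
              (koszulOp (fderiv ℝ (Kerr.bilin M a) q.1.1 + q.2.2) q.1.2 q.1.2))) - ρ * fderiv ℝ (F ∘ Kerr.radius a) q.1.1 q.1.2 ^ 2 < 0) := by
  -- continuity of the Kerr jets at `y`
  have hcG : ContinuousAt (Kerr.bilin M a) y := (Kerr.contDiffAt_bilin M a hy (n := 0)).continuousAt
  have hcdG : ContinuousAt (fderiv ℝ (Kerr.bilin M a)) y :=
    ((Kerr.contDiffAt_bilin M a hy (n := 1)).fderiv_right (m := 0) (by norm_num)).continuousAt
  have hcV : ContinuousAt (Kerr.timeVector M a) y := (Kerr.contDiffAt_timeVector M a hy (n := 0)).continuousAt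
  have hcr : ContinuousAt (Kerr.radius a) y := (Kerr.continuous_radius a).continuousAt
  have hf2 : ContDiffAt ℝ 2 (F ∘ Kerr.radius a) y := hcert.1.contDiffAt.comp y (Kerr.contDiffAt_radius hy)
  have hcdf : ContinuousAt (fderiv ℝ (F ∘ Kerr.radius a)) y := (hf2.fderiv_right (m := 1) (by norm_num)).continuousAt
  have hcddf : ContinuousAt (fderiv ℝ (fderiv ℝ (F ∘ Kerr.radius a))) y :=
    ((hf2.fderiv_right (m := 1) (by norm_num)).fderiv_right (m := 0) (by norm_num)).continuousAt
  have hcF : Continuous F := hcert.1.continuous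
  -- the coordinate projections of the parameter space
  have h11 : Continuous fun q : (E4 × E4) × ((E4 →L[ℝ] E4 →L[ℝ] ℝ) × (E4 →L[ℝ] E4 →L[ℝ] E4 →L[ℝ] ℝ)) => q.1.1 := continuous_fst.comp continuous_fst
  have h12 : Continuous fun q : (E4 × E4) × ((E4 →L[ℝ] E4 →L[ℝ] ℝ) × (E4 →L[ℝ] E4 →L[ℝ] E4 →L[ℝ] ℝ)) => q.1.2 := continuous_snd.comp continuous_fst
  have h21 : Continuous fun q : (E4 × E4) × ((E4 →L[ℝ] E4 →L[ℝ] ℝ) × (E4 →L[ℝ] E4 →L[ℝ] E4 →L[ℝ] ℝ)) => q.2.1 := continuous_fst.comp continuous_snd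
  have h22 : Continuous fun q : (E4 × E4) × ((E4 →L[ℝ] E4 →L[ℝ] ℝ) × (E4 →L[ℝ] E4 →L[ℝ] E4 →L[ℝ] ℝ)) => q.2.2 := continuous_snd.comp continuous_snd
  -- continuity of the pieces at `q₀ = ((y, v), 0)` (every composite stated with its type, so that no
  -- higher-order unification is left to the elaborator)
  have hGq : ContinuousAt (Kerr.bilin M a ∘ fun q : (E4 × E4) × ((E4 →L[ℝ] E4 →L[ℝ] ℝ) × (E4 →L[ℝ] E4 →L[ℝ] E4 →L[ℝ] ℝ)) => q.1.1) ((y, v), 0) :=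
    ContinuousAt.comp_of_eq hcG (h11.continuousAt (x := ((y, v), 0))) rfl
  have hdGq : ContinuousAt (fun q : (E4 × E4) × ((E4 →L[ℝ] E4 →L[ℝ] ℝ) × (E4 →L[ℝ] E4 →L[ℝ] E4 →L[ℝ] ℝ)) => fderiv ℝ (Kerr.bilin M a) q.1.1) ((y, v), 0) :=
    ContinuousAt.comp_of_eq hcdG (h11.continuousAt (x := ((y, v), 0))) rfl
  have hVq : ContinuousAt (Kerr.timeVector M a ∘ fun q : (E4 × E4) × ((E4 →L[ℝ] E4 →L[ℝ] ℝ) × (E4 →L[ℝ] E4 →L[ℝ] E4 →L[ℝ] ℝ)) => q.1.1) ((y, v), 0) :=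
    ContinuousAt.comp_of_eq hcV (h11.continuousAt (x := ((y, v), 0))) rfl
  have hB : ContinuousAt (fun q : (E4 × E4) × ((E4 →L[ℝ] E4 →L[ℝ] ℝ) × (E4 →L[ℝ] E4 →L[ℝ] E4 →L[ℝ] ℝ)) => fderiv ℝ (F ∘ Kerr.radius a) q.1.1) ((y, v), 0) :=
    ContinuousAt.comp_of_eq hcdf (h11.continuousAt (x := ((y, v), 0))) rfl
  have hddfq : ContinuousAt (fun q : (E4 × E4) × ((E4 →L[ℝ] E4 →L[ℝ] ℝ) × (E4 →L[ℝ] E4 →L[ℝ] E4 →L[ℝ] ℝ)) => fderiv ℝ (fderiv ℝ (F ∘ Kerr.radius a)) q.1.1)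
      ((y, v), 0) :=
    ContinuousAt.comp_of_eq hcddf (h11.continuousAt (x := ((y, v), 0))) rfl
  have hrq : ContinuousAt (Kerr.radius a ∘ fun q : (E4 × E4) × ((E4 →L[ℝ] E4 →L[ℝ] ℝ) × (E4 →L[ℝ] E4 →L[ℝ] E4 →L[ℝ] ℝ)) => q.1.1) ((y, v), 0) :=
    ContinuousAt.comp_of_eq hcr (h11.continuousAt (x := ((y, v), 0))) rfl
  have hA : ContinuousAt (fun q : (E4 × E4) × ((E4 →L[ℝ] E4 →L[ℝ] ℝ) × (E4 →L[ℝ] E4 →L[ℝ] E4 →L[ℝ] ℝ)) => Kerr.bilin M a q.1.1 + q.2.1) ((y, v), 0) :=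
    hGq.add h21.continuousAt
  have hdA : ContinuousAt (fun q : (E4 × E4) × ((E4 →L[ℝ] E4 →L[ℝ] ℝ) × (E4 →L[ℝ] E4 →L[ℝ] E4 →L[ℝ] ℝ)) => fderiv ℝ (Kerr.bilin M a) q.1.1 + q.2.2)
      ((y, v), 0) :=
    hdGq.add h22.continuousAt
  have hC : ContinuousAt (fun q : (E4 × E4) × ((E4 →L[ℝ] E4 →L[ℝ] ℝ) × (E4 →L[ℝ] E4 →L[ℝ] E4 →L[ℝ] ℝ)) =>
      fderiv ℝ (fderiv ℝ (F ∘ Kerr.radius a)) q.1.1 q.1.2 q.1.2) ((y, v), 0) :=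
    (hddfq.clm_apply h12.continuousAt).clm_apply h12.continuousAt
  have hinv0 : (Kerr.bilin M a y).IsInvertible :=
    isInvertible_of_nondegenerate fun w hw => Kerr.bilin_nondegenerate M a hy w hw
  have hinvc : ContinuousAt (ContinuousLinearMap.inverse : (E4 →L[ℝ] E4 →L[ℝ] ℝ) → _)
      (Kerr.bilin M a y + (0 : ((E4 →L[ℝ] E4 →L[ℝ] ℝ) × (E4 →L[ℝ] E4 →L[ℝ] E4 →L[ℝ] ℝ))).1) := by
    have h := (hinv0.contDiffAt_map_inverse (n := 0)).continuousAt
    simp only [Prod.fst_zero, add_zero]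
    exact h
  have hD : ContinuousAt (fun q : (E4 × E4) × ((E4 →L[ℝ] E4 →L[ℝ] ℝ) × (E4 →L[ℝ] E4 →L[ℝ] E4 →L[ℝ] ℝ)) => (Kerr.bilin M a q.1.1 + q.2.1).inverse) ((y, v), 0) :=
    ContinuousAt.comp (g := (ContinuousLinearMap.inverse : (E4 →L[ℝ] E4 →L[ℝ] ℝ) → _)) hinvc hA
  have hKq : ContinuousAt (fun q : (E4 × E4) × ((E4 →L[ℝ] E4 →L[ℝ] ℝ) × (E4 →L[ℝ] E4 →L[ℝ] E4 →L[ℝ] ℝ)) =>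
      koszulOp (fderiv ℝ (Kerr.bilin M a) q.1.1 + q.2.2)) ((y, v), 0) :=
    ContinuousAt.comp (g := fun T : E4 →L[ℝ] E4 →L[ℝ] E4 →L[ℝ] ℝ => koszulOp T)
      koszulOp.continuous.continuousAt hdA
  have hE : ContinuousAt (fun q : (E4 × E4) × ((E4 →L[ℝ] E4 →L[ℝ] ℝ) × (E4 →L[ℝ] E4 →L[ℝ] E4 →L[ℝ] ℝ)) =>
      koszulOp (fderiv ℝ (Kerr.bilin M a) q.1.1 + q.2.2) q.1.2 q.1.2) ((y, v), 0) :=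
    (hKq.clm_apply h12.continuousAt).clm_apply h12.continuousAt
  have hDE : ContinuousAt (fun q : (E4 × E4) × ((E4 →L[ℝ] E4 →L[ℝ] ℝ) × (E4 →L[ℝ] E4 →L[ℝ] E4 →L[ℝ] ℝ)) =>
      (Kerr.bilin M a q.1.1 + q.2.1).inverse (koszulOp (fderiv ℝ (Kerr.bilin M a) q.1.1 + q.2.2) q.1.2 q.1.2))
      ((y, v), 0) :=
    hD.clm_apply hE
  have hDE2 : ContinuousAt (fun q : (E4 × E4) × ((E4 →L[ℝ] E4 →L[ℝ] ℝ) × (E4 →L[ℝ] E4 →L[ℝ] E4 →L[ℝ] ℝ)) => (2⁻¹ : ℝ) •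
      (Kerr.bilin M a q.1.1 + q.2.1).inverse (koszulOp (fderiv ℝ (Kerr.bilin M a) q.1.1 + q.2.2) q.1.2 q.1.2))
      ((y, v), 0) :=
    hDE.const_smul (2⁻¹ : ℝ)
  have hBDE : ContinuousAt (fun q : (E4 × E4) × ((E4 →L[ℝ] E4 →L[ℝ] ℝ) × (E4 →L[ℝ] E4 →L[ℝ] E4 →L[ℝ] ℝ)) => fderiv ℝ (F ∘ Kerr.radius a) q.1.1 ((2⁻¹ : ℝ) •
      (Kerr.bilin M a q.1.1 + q.2.1).inverse (koszulOp (fderiv ℝ (Kerr.bilin M a) q.1.1 + q.2.2) q.1.2 q.1.2)))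
      ((y, v), 0) :=
    hB.clm_apply hDE2
  have hJ : ContinuousAt (fun q : (E4 × E4) × ((E4 →L[ℝ] E4 →L[ℝ] ℝ) × (E4 →L[ℝ] E4 →L[ℝ] E4 →L[ℝ] ℝ)) =>
      fderiv ℝ (fderiv ℝ (F ∘ Kerr.radius a)) q.1.1 q.1.2 q.1.2 - fderiv ℝ (F ∘ Kerr.radius a) q.1.1 ((2⁻¹ : ℝ) •
        (Kerr.bilin M a q.1.1 + q.2.1).inverse (koszulOp (fderiv ℝ (Kerr.bilin M a) q.1.1 + q.2.2) q.1.2 q.1.2)))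
      ((y, v), 0) :=
    hC.sub hBDE
  have hFr : ContinuousAt (fun q : (E4 × E4) × ((E4 →L[ℝ] E4 →L[ℝ] ℝ) × (E4 →L[ℝ] E4 →L[ℝ] E4 →L[ℝ] ℝ)) => F (Kerr.radius a q.1.1)) ((y, v), 0) :=
    ContinuousAt.comp (g := F) hcF.continuousAt hrq
  have hdfv : ContinuousAt (fun q : (E4 × E4) × ((E4 →L[ℝ] E4 →L[ℝ] ℝ) × (E4 →L[ℝ] E4 →L[ℝ] E4 →L[ℝ] ℝ)) => fderiv ℝ (F ∘ Kerr.radius a) q.1.1 q.1.2)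
      ((y, v), 0) :=
    hB.clm_apply h12.continuousAt
  have hFJ : ContinuousAt (fun q : (E4 × E4) × ((E4 →L[ℝ] E4 →L[ℝ] ℝ) × (E4 →L[ℝ] E4 →L[ℝ] E4 →L[ℝ] ℝ)) =>
      F (Kerr.radius a q.1.1) * (fderiv ℝ (fderiv ℝ (F ∘ Kerr.radius a)) q.1.1 q.1.2 q.1.2 -
        fderiv ℝ (F ∘ Kerr.radius a) q.1.1 ((2⁻¹ : ℝ) •
        (Kerr.bilin M a q.1.1 + q.2.1).inverse (koszulOp (fderiv ℝ (Kerr.bilin M a) q.1.1 + q.2.2) q.1.2 q.1.2))))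
      ((y, v), 0) :=
    hFr.mul hJ
  have hρd : ContinuousAt (fun q : (E4 × E4) × ((E4 →L[ℝ] E4 →L[ℝ] ℝ) × (E4 →L[ℝ] E4 →L[ℝ] E4 →L[ℝ] ℝ)) => ρ * (fderiv ℝ (F ∘ Kerr.radius a) q.1.1 q.1.2) ^ 2)
      ((y, v), 0) :=
    (hdfv.pow 2).const_mul ρ
  have hW : ContinuousAt (fun q : (E4 × E4) × ((E4 →L[ℝ] E4 →L[ℝ] ℝ) × (E4 →L[ℝ] E4 →L[ℝ] E4 →L[ℝ] ℝ)) =>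
      F (Kerr.radius a q.1.1) * (fderiv ℝ (fderiv ℝ (F ∘ Kerr.radius a)) q.1.1 q.1.2 q.1.2 -
        fderiv ℝ (F ∘ Kerr.radius a) q.1.1 ((2⁻¹ : ℝ) •
        (Kerr.bilin M a q.1.1 + q.2.1).inverse (koszulOp (fderiv ℝ (Kerr.bilin M a) q.1.1 + q.2.2) q.1.2 q.1.2))) -
        ρ * (fderiv ℝ (F ∘ Kerr.radius a) q.1.1 q.1.2) ^ 2) ((y, v), 0) :=
    hFJ.sub hρd
  have hAv : ContinuousAt (fun q : (E4 × E4) × ((E4 →L[ℝ] E4 →L[ℝ] ℝ) × (E4 →L[ℝ] E4 →L[ℝ] E4 →L[ℝ] ℝ)) => (Kerr.bilin M a q.1.1 + q.2.1) q.1.2) ((y, v), 0) :=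
    hA.clm_apply h12.continuousAt
  have hAV : ContinuousAt (fun q : (E4 × E4) × ((E4 →L[ℝ] E4 →L[ℝ] ℝ) × (E4 →L[ℝ] E4 →L[ℝ] E4 →L[ℝ] ℝ)) => (Kerr.bilin M a q.1.1 + q.2.1) (Kerr.timeVector M a q.1.1))
      ((y, v), 0) :=
    hA.clm_apply hVq
  have hα : ContinuousAt (fun q : (E4 × E4) × ((E4 →L[ℝ] E4 →L[ℝ] ℝ) × (E4 →L[ℝ] E4 →L[ℝ] E4 →L[ℝ] ℝ)) => (Kerr.bilin M a q.1.1 + q.2.1) q.1.2 q.1.2) ((y, v), 0) :=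
    hAv.clm_apply h12.continuousAt
  have hβ : ContinuousAt (fun q : (E4 × E4) × ((E4 →L[ℝ] E4 →L[ℝ] ℝ) × (E4 →L[ℝ] E4 →L[ℝ] E4 →L[ℝ] ℝ)) =>
      (Kerr.bilin M a q.1.1 + q.2.1) q.1.2 (Kerr.timeVector M a q.1.1)) ((y, v), 0) :=
    hAv.clm_apply hVq
  have hγ : ContinuousAt (fun q : (E4 × E4) × ((E4 →L[ℝ] E4 →L[ℝ] ℝ) × (E4 →L[ℝ] E4 →L[ℝ] E4 →L[ℝ] ℝ)) =>
      (Kerr.bilin M a q.1.1 + q.2.1) (Kerr.timeVector M a q.1.1) (Kerr.timeVector M a q.1.1)) ((y, v), 0) :=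
    hAV.clm_apply hVq
  -- (1) invertibility is open
  have h1 : ∀ᶠ q in 𝓝 (((y, v), 0) : (E4 × E4) × ((E4 →L[ℝ] E4 →L[ℝ] ℝ) × (E4 →L[ℝ] E4 →L[ℝ] E4 →L[ℝ] ℝ))), ((Kerr.bilin M a) q.1.1 + q.2.1).IsInvertible := by
    have hmem : range ((↑) : (E4 ≃L[ℝ] E4 →L[ℝ] ℝ) → E4 →L[ℝ] E4 →L[ℝ] ℝ) ∈ 𝓝 ((Kerr.bilin M a) y + (0 : ((E4 →L[ℝ] E4 →L[ℝ] ℝ) × (E4 →L[ℝ] E4 →L[ℝ] E4 →L[ℝ] ℝ))).1) := by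
      refine ContinuousLinearEquiv.isOpen.mem_nhds ?_
      obtain ⟨e, he⟩ := hinv0
      exact ⟨e, by rw [he]; simp⟩
    filter_upwards [hA.preimage_mem_nhds hmem] with q hq
    obtain ⟨e, he⟩ := hq
    exact ⟨e, he⟩
  -- (2) `V` stays timelike
  have h2 : ∀ᶠ q in 𝓝 (((y, v), 0) : (E4 × E4) × ((E4 →L[ℝ] E4 →L[ℝ] ℝ) × (E4 →L[ℝ] E4 →L[ℝ] E4 →L[ℝ] ℝ))),
      ((Kerr.bilin M a) q.1.1 + q.2.1) (Kerr.timeVector M a q.1.1) (Kerr.timeVector M a q.1.1) < 0 := by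
    have h0 : ((Kerr.bilin M a) y + (0 : ((E4 →L[ℝ] E4 →L[ℝ] ℝ) × (E4 →L[ℝ] E4 →L[ℝ] E4 →L[ℝ] ℝ))).1) (Kerr.timeVector M a y) (Kerr.timeVector M a y) < 0 := by
      simp only [Prod.fst_zero, add_zero]
      exact Kerr.bilin_timeVector_timeVector_neg hM a hy
    exact hγ.eventually_lt continuousAt_const h0
  -- (3) the implication
  have h3 : ∀ᶠ q in 𝓝 (((y, v), 0) : (E4 × E4) × ((E4 →L[ℝ] E4 →L[ℝ] ℝ) × (E4 →L[ℝ] E4 →L[ℝ] E4 →L[ℝ] ℝ))), ((Kerr.bilin M a) q.1.1 + q.2.1) q.1.2 q.1.2 = 0 →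
      (((Kerr.bilin M a) q.1.1 + q.2.1) q.1.2 (Kerr.timeVector M a q.1.1) < 0 → fderiv ℝ (F ∘ Kerr.radius a) q.1.1 q.1.2 < 0) ∧
        F (Kerr.radius a q.1.1) * (fderiv ℝ (fderiv ℝ (F ∘ Kerr.radius a)) q.1.1 q.1.2 q.1.2 - fderiv ℝ (F ∘ Kerr.radius a) q.1.1 ((2⁻¹ : ℝ) •
          ((Kerr.bilin M a) q.1.1 + q.2.1).inverse (koszulOp (fderiv ℝ (Kerr.bilin M a) q.1.1 + q.2.2) q.1.2 q.1.2))) -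
          ρ * (fderiv ℝ (F ∘ Kerr.radius a) q.1.1 q.1.2) ^ 2 < 0 := by
    by_cases hnull : (Kerr.bilin M a) y v v = 0
    · -- the certificate at the base point
      obtain ⟨hslope, hconc⟩ := hcert.2.2 y hy₁ hy₂ v hnull
      have hvn : 0 < ‖v‖ := norm_pos_iff.2 hv
      -- second conjunct: strict at the base point, hence nearby
      have hW0 : F (Kerr.radius a y) * (fderiv ℝ (fderiv ℝ (F ∘ Kerr.radius a)) y v v - fderiv ℝ (F ∘ Kerr.radius a) y ((2⁻¹ : ℝ) •
          ((Kerr.bilin M a) y + (0 : ((E4 →L[ℝ] E4 →L[ℝ] ℝ) × (E4 →L[ℝ] E4 →L[ℝ] E4 →L[ℝ] ℝ))).1).inverse (koszulOp (fderiv ℝ (Kerr.bilin M a) y + (0 : ((E4 →L[ℝ] E4 →L[ℝ] ℝ) × (E4 →L[ℝ] E4 →L[ℝ] E4 →L[ℝ] ℝ))).2) v v))) -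
          ρ * (fderiv ℝ (F ∘ Kerr.radius a) y v) ^ 2 < 0 := by
        simp only [Prod.fst_zero, Prod.snd_zero, add_zero]
        have h := hconc
        rw [hessAt_apply, chrAt_apply] at h
        have hm' : -(m * ‖v‖ ^ 2) < 0 := by
          have := mul_pos hm (pow_pos hvn 2)
          linarith
        exact lt_of_le_of_lt h hm'
      have hWev := hW.eventually_lt continuousAt_const hW0
      -- first conjunct: the sign of `g(v, V)` at the base point decides
      have hne : (Kerr.bilin M a) y v (Kerr.timeVector M a y) ≠ 0 := crushTransport_bilin_timeVector_ne_zero hM hy hnull hv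
      rcases hne.lt_or_gt with hlt | hgt
      · have hd0 : fderiv ℝ (F ∘ Kerr.radius a) y v < 0 := by
          have h := hslope hlt
          have : -(m * ‖v‖) < 0 := by
            have := mul_pos hm hvn
            linarith
          exact lt_of_le_of_lt h this
        have hdev := hdfv.eventually_lt continuousAt_const hd0
        filter_upwards [hWev, hdev] with q hq1 hq2 _ using ⟨fun _ => hq2, hq1⟩
      · have hgt' : 0 < ((Kerr.bilin M a) y + (0 : ((E4 →L[ℝ] E4 →L[ℝ] ℝ) × (E4 →L[ℝ] E4 →L[ℝ] E4 →L[ℝ] ℝ))).1) v (Kerr.timeVector M a y) := by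
          simp only [Prod.fst_zero, add_zero]; exact hgt
        have hpos := hβ.eventually_const_lt hgt'
        filter_upwards [hWev, hpos] with q hq1 hq2 _ using ⟨fun h => absurd h (not_lt.2 hq2.le), hq1⟩
    · have h0 : ((Kerr.bilin M a) y + (0 : ((E4 →L[ℝ] E4 →L[ℝ] ℝ) × (E4 →L[ℝ] E4 →L[ℝ] E4 →L[ℝ] ℝ))).1) v v ≠ 0 := by simp only [Prod.fst_zero, add_zero]; exact hnull
      filter_upwards [hα.eventually_ne h0] with q hq hq0 using absurd hq0 hq
  filter_upwards [h1, h2, h3] with q hq1 hq2 hq3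
  exact ⟨hq1, hq2, hq3⟩

/-- **Registered sub-goal `stub_crushTransportJetStable`** (helper of stub `stub_crushTransport`, line
`null-concave-crush`): the local jet-level `C¹`-stability of the Kerr crush certificate, i.e.
`crushTransport_good_eventually` in registered one-line form. [folklore] -/
theorem stub_crushTransportJetStable : ∀ (M a r₁ r₂ ρ m : ℝ) (F : ℝ → ℝ) (y v : E4), 0 ≤ M → 0 < m → KerrCrushCertificate M a r₁ r₂ ρ m F → 0 < Kerr.radius a y → r₁ ≤ Kerr.radius a y → Kerr.radius a y ≤ r₂ → v ≠ 0 → ∀ᶠ q in 𝓝 (((y, v), 0) : (E4 × E4) × ((E4 →L[ℝ] E4 →L[ℝ] ℝ) × (E4 →L[ℝ] E4 →L[ℝ] E4 →L[ℝ] ℝ))), (Kerr.bilin M a q.1.1 + q.2.1).IsInvertible ∧ (Kerr.bilin M a q.1.1 + q.2.1) (Kerr.timeVector M a q.1.1) (Kerr.timeVector M a q.1.1) < 0 ∧ ((Kerr.bilin M a q.1.1 + q.2.1) q.1.2 q.1.2 = 0 → ((Kerr.bilin M a q.1.1 + q.2.1) q.1.2 (Kerr.timeVector M a q.1.1) < 0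 → fderiv ℝ (F ∘ Kerr.radius a) q.1.1 q.1.2 < 0) ∧ F (Kerr.radius a q.1.1) * (fderiv ℝ (fderiv ℝ (F ∘ Kerr.radius a)) q.1.1 q.1.2 q.1.2 - fderiv ℝ (F ∘ Kerr.radius a) q.1.1 ((2⁻¹ : ℝ) • (Kerr.bilin M a q.1.1 + q.2.1).inverse (MetricCoord.koszulOp (fderiv ℝ (Kerr.bilin M a) q.1.1 + q.2.2) q.1.2 q.1.2))) - ρ * fderiv ℝ (F ∘ Kerr.radius a) q.1.1 q.1.2 ^ 2 < 0) := by
  intro M a r₁ r₂ ρ m F y v hM hm hcert hy hy₁ hy₂ hv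
  exact crushTransport_good_eventually hM hm hcert hy hy₁ hy₂ hv

end Perturbation

end Summit.FinalStateConjecture.FinalStateConjecture.Theorems.BartnikGapSettling.SettledCapture

end
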